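import Summits.BirchSwinnertonDyer.BirchSwinnertonDyer.Theorems.GenusKolyvaginAtTwoMinimalTwinBSDTwoOddManinDatum
import Summits.BirchSwinnertonDyer.BirchSwinnertonDyer.Theorems.ManinLocalTwoThreeManinOddAtFourCdtThm1
import HarnessLib

/-!
# Route `GenusKolyvaginAtTwo`, crux U₂ `MinimalTwinBSDTwo` (stmt-BirchSwinnertonDyer-22985) and aside `GenusPrimitiveSupplyAtTwo` (stmt-BirchSwinnertonDyer-22136):
# A LATTICE-OPTIMAL DATUM HAS ODD MANIN CONSTANT AT EVERY LEVEL — closed as typed (Abbes–Ullmo / Česnavičius on `4 ∤ N`; the closed crux 22967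
# `ManinLocalTwoThree.ManinOddAtFour` on `4 ∣ N`)

Seat `bsd-line-gk2-p2` g37 (PROVER seat 2/3, cell `bsd-f1-sign2`, LINE 23 holder), `--supports stmt-BirchSwinnertonDyer-22985 --as helper`.
THEOREMS ONLY (no definition, no named fact, no `sorry`).  BSD is NOT proved by any of this; nothing is closed by this file.

WHAT.  g33's `OddManin.odd_c_of_latticeEq_of_not_four_dvd` (p816794: a lattice-optimal datum at a level `N` with `4 ∤ N` has odd `c`, Abbes–Ullmo 1996 Thm. A /
Česnavičius 2018 Thm. 1.2 verbatim) loses its level hypothesis: on `4 ∣ N` the CLOSED crux `ManinLocalTwoThree.ManinOddAtFour` (stmt-BirchSwinnertonDyer-22967,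
`ManinLocalTwoThree.ManinOddAtFour_proof`, 2026-08-31T16:49Z; status of record per director-bsd (849)(4)/(853)(1)/(878)(d): PROVED AS TYPED, UDC-DEPENDENT via
`calegariDimitrovTang2025_unboundedDenominators_holds`, audit (P†) pending, NOT an announcement of Manin's conjecture) gives `2 ∤ c`.  So the habitat clause
«an optimal parametrisation WITH ODD Manin constant» of `GenusPrimitiveSupplyAtTwo` (22136) and the `Odd Dt.c` binders of K1Neg/K1Pos/K4Neg/K4Pos next to
lattice-optimality reduce to optimality alone, at EVERY conductor, modulo four PRINT named facts (Mazur 1978 Cor. 4.1, Abbes–Ullmo 1996 Thm. A, Česnavičius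
2018 Thm. 1.2 — lattice renderings — and modularity `exists_isNewformOf`).  Inherits 22967's status on `4 ∣ N`.
* `odd_c_of_latticeEq_of_printedFacts`, `not_two_dvd_maninConstant_of_latticeEq_of_printedFacts`, `exists_latticeEq_and_odd_iff_of_printedFacts`.

References: [AbbesUllmo1996] Thm. A; [Cesnavicius2018] Thm. 1.2; [Mazur1978] Cor. 4.1; [CalegariDimitrovTang2025] Thm. 1.0.1; [Stevens1982] §1.3 Thm. 1.3.1 (b).
-/

set_option autoImplicit false
set_option linter.dupNamespace false -- `Summit.<P>.<Sub>` repeats `BirchSwinnertonDyer` (D-0017)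

noncomputable section

open scoped Classical MatrixGroups ModularForm

namespace Summit.BirchSwinnertonDyer.BirchSwinnertonDyer.Theorems.GenusExact.TwinSwap.OddManin

open Literature.NumberTheory.EllipticCurves WeierstrassCurve CongruenceSubgroup
  Literature.NumberTheory.EllipticCurves.ModularForms

/-- **A lattice-optimal datum has `2 ∤ c` at every level, closed as typed.**  `W/ℚ` globally minimal elliptic, `D` a datum at level `N` with the lattice
clause `Λ_W ⊆ c·Λ_f` (hence `= c·Λ_f`: the optimal parametrisation of the strong Weil curve); granted Mazur 1978 Cor. 4.1, Abbes–Ullmo 1996 Thm. A,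
Česnavičius 2018 Thm. 1.2 (lattice renderings) and modularity `exists_isNewformOf`: `¬ 2 ∣ D.maninConstant`.  Case `4 ∤ N`: Abbes–Ullmo (`2 ∤ N`) /
Česnavičius (`2 ∥ N`) verbatim; case `4 ∣ N`: the closed crux 22967 `ManinOddAtFour_proof` (PROVED AS TYPED, UDC-dependent, (P†) pending).  CONDITIONAL
on the four displayed facts; BSD is NOT proved. [cite: AbbesUllmo1996, Thm. A] [cite: Cesnavicius2018, Thm. 1.2 (p = 2, ord_2(n) = 1)]
[cite: CalegariDimitrovTang2025, Thm. 1.0.1] [cite: Mazur1978, Cor. 4.1] -/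
theorem not_two_dvd_maninConstant_of_latticeEq_of_printedFacts
    (hMaz : mazur_not_dvd_maninConstant_of_odd) (hAU : abbesUllmo_not_dvd_maninConstant_of_not_dvd_level)
    (hCes : cesnavicius_not_two_dvd_maninConstant_of_two_dvd_level) (hnf : exists_isNewformOf)
    (W : WeierstrassCurve ℚ) [W.IsElliptic] [W.IsGloballyMinimal] {N : ℕ} [NeZero N] (D : ModularParametrizationData W N)
    (hopt : ∀ z ∈ D.L.lattice, ∃ w ∈ periodLattice D.f, z = D.c * w) : ¬ (2 : ℤ) ∣ D.maninConstant := by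
  by_cases h4 : 2 ^ 2 ∣ N
  · exact ManinLocalTwoThree.ManinOddAtFour_proof hMaz hAU hCes hnf W D hopt h4
  · by_cases h2 : 2 ∣ N
    · exact hCes W D hopt h2 h4
    · exact_mod_cast hAU W D hopt 2 Nat.prime_two h2

/-- **A lattice-optimal datum has ODD Manin constant at every level, closed as typed** (`Odd` form of
`not_two_dvd_maninConstant_of_latticeEq_of_printedFacts`; g33's `odd_c_of_latticeEq_of_not_four_dvd` without the level hypothesis).  CONDITIONAL on the four
displayed facts; inherits 22967's status on `4 ∣ N`; BSD is NOT proved. [cite: AbbesUllmo1996, Thm. A] [cite: Cesnavicius2018, Thm. 1.2]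
[cite: CalegariDimitrovTang2025, Thm. 1.0.1] -/
theorem odd_c_of_latticeEq_of_printedFacts
    (hMaz : mazur_not_dvd_maninConstant_of_odd) (hAU : abbesUllmo_not_dvd_maninConstant_of_not_dvd_level)
    (hCes : cesnavicius_not_two_dvd_maninConstant_of_two_dvd_level) (hnf : exists_isNewformOf)
    (W : WeierstrassCurve ℚ) [W.IsElliptic] [W.IsGloballyMinimal] {N : ℕ} [NeZero N] (D : ModularParametrizationData W N)
    (hopt : ∀ z ∈ D.L.lattice, ∃ w ∈ periodLattice D.f, z = D.c * w) : Odd D.c := by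
  have hc : ¬ (2 : ℤ) ∣ D.c := not_two_dvd_maninConstant_of_latticeEq_of_printedFacts hMaz hAU hCes hnf W D hopt
  rcases Int.even_or_odd D.c with h | h
  · exact absurd (even_iff_two_dvd.mp h) hc
  · exact h

/-- **At every level the habitat clause «optimal with odd Manin constant» reduces to optimality**: `(∃ Dt, Λ_W = c·Λ_f ∧ Odd Dt.c) ↔ (∃ Dt, Λ_W = c·Λ_f)`,
modulo the four displayed facts (g33's `exists_latticeEq_and_odd_iff_of_not_four_dvd` without `4 ∤ N`) — the clause of `GenusPrimitiveSupplyAtTwo` (22136)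
and the `Odd Dt.c` binders of K1Neg/K1Pos/K4Neg/K4Pos next to lattice-optimality are automatic, closed as typed.  BSD is NOT proved.
[cite: AbbesUllmo1996, Thm. A] [cite: Cesnavicius2018, Thm. 1.2] [cite: CalegariDimitrovTang2025, Thm. 1.0.1] -/
theorem exists_latticeEq_and_odd_iff_of_printedFacts
    (hMaz : mazur_not_dvd_maninConstant_of_odd) (hAU : abbesUllmo_not_dvd_maninConstant_of_not_dvd_level)
    (hCes : cesnavicius_not_two_dvd_maninConstant_of_two_dvd_level) (hnf : exists_isNewformOf)
    (W : WeierstrassCurve ℚ) [W.IsElliptic] [W.IsGloballyMinimal] {N : ℕ} [NeZero N] :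
    (∃ Dt : ModularParametrizationData W N, (∀ z ∈ Dt.L.lattice, ∃ w ∈ periodLattice Dt.f, z = (Dt.c : ℂ) * w) ∧ Odd Dt.c) ↔
      ∃ Dt : ModularParametrizationData W N, ∀ z ∈ Dt.L.lattice, ∃ w ∈ periodLattice Dt.f, z = (Dt.c : ℂ) * w :=
  ⟨fun ⟨Dt, hopt, _⟩ ↦ ⟨Dt, hopt⟩, fun ⟨Dt, hopt⟩ ↦ ⟨Dt, hopt, odd_c_of_latticeEq_of_printedFacts hMaz hAU hCes hnf W Dt hopt⟩⟩

end Summit.BirchSwinnertonDyer.BirchSwinnertonDyer.Theorems.GenusExact.TwinSwap.OddManin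

end
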